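import Summits.BirchSwinnertonDyer.Rank1Residual.Additive.TameBranchOfHeckeSymbol
import HarnessLib

/-!
# RIGIDITY OF THE ORDINARY TWIST PARTNER: the typed input `CensusX43.HasOrdinaryTwistPartner χ f`
# (defect `e ∈ {3,4,6}`: the symbol of Delbourgo's `p`-ordinary newform `f̃ = f_E ⊗ ε̄`) has NO
# freedom — the partner satisfies an explicit functional equation in `f`'s OWN symbols, forces
# `U_p [·]⁺_f = 0`, is UNIQUE for its eigenvalue, and is given on the `p`-power tower by a closed
# formula (cell `b2b-bsdres`, sub-cell additive-p2 = X3♯(G-ord) / X4♯(G-ord), gen 23)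

HONEST FRAMING (cell `b2b-bsdres`, run/shared/lean/b2b/bsd-rank1-residual/, verbatim in every
file): the goal of the cell is to DELETE the COMBINATION-SHAPED residual classes of the
Birch–Swinnerton-Dyer formula for ALL analytic-rank `≤ 1` elliptic curves over `ℚ` — "full BSD
formula for every rank `≤ 1` curve in class `C`" assembled STRICTLY from published theorems — so
that the rank-`≤ 1` remainder becomes exactly the CONSTRUCTION-SHAPED classes, which are TYPED
(missing-input `Prop`s), NOT attempted. This is not "finishing BSD". Sub-cell additive-p2: the
classes X3♯(G-ord) / X4♯(G-ord) are CONSTRUCTION-SHAPED and stay so; labels / RESIDUAL-MAP marks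
UNCHANGED; nothing is booked. THEOREMS ONLY (no definition, no named fact, no conjecture node);
pure `p`-adic bookkeeping on functions `ℚ → ℚ_p`.

## What, and why

On the potentially good ORDINARY rows of DEFECT `e ∈ {3,4,6}` (this seat's located gap R3′:
Kato's Thm. 17.4 does not reach Delbourgo's `p`-new newform `f̃`, AUDIT-X34-GORD §4) the analytic
object of every typed statement of the tame-branch route — `TameBranchRatCharEqAt` (N10),
`TameBranchRatDvdAt` (A227's Kato half), `CharLamLeAt` — is an E-normalised tame branch
`IsTameBranchOf f p (ι∘χ) ã B` (`TameBranchLower.lean`), and the tree PRODUCES such a `B`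
(`exists_isTameBranchOf_of_twistPartnerData`, `TameBranchOfHeckeSymbol.lean`) from exactly one typed
modular-forms input, cc-typer-2's **`CensusX43.HasOrdinaryTwistPartner χ f`**
(`CensusX43ValueModule.lean`): a `1`-periodic `Φ : ℚ → ℚ_p` with attained sup norm and a unit `ã`
with (α) `[·]⁺_f = τ_{χ⁻¹} Φ` and (β) `∑_{d mod p} Φ(s + d/p) = ã·Φ(ps)` — in print, `Φ` = the
symbol of Delbourgo's newform `f̃ = f_E ⊗ ε̄ ∈ S₂(Γ₁(pN'), ε̄²)` and `ã` its unit `U_p`-eigenvalue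
(Delbourgo 1998 §1.5; Atkin–Li 1978), objects the tree does not have. On defect `2` the input is a
THEOREM (`hasOrdinaryTwistPartner_of_heckeSymbol` run on the twist curve `E♭`; the dictionary of
gen 22). This file shows that the input has NO FREEDOM beyond one number and one boundedness claim:

* §1 `eq_source_add_mul` — THE FUNCTIONAL EQUATION: every partner `(Φ, ã)` of `(x, χ)` (`x` any
  `1`-periodic function, `χ ≠ 1`; no `U_p` hypothesis) satisfies, for every `s ∈ ℚ`,
  `Φ(s) = S(s) + (ã/p)·Φ(ps)` with the SOURCE `S(s) := (χ(−1)/p)·τ_χ x(s) = (χ(−1)/p)∑_b χ(b)x(s+b/p)`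
  EXPLICIT in `x` — `τ_χ τ_{χ⁻¹} = χ(−1)(p − ∑_d τ_{d/p})` (cc-typer-1's `CensusX43.twist_twist_inv`,
  Jacobi sum `J(χ,χ⁻¹) = −χ(−1)`) and (β);
* §1 `sum_apply_add_div_eq_zero` — NECESSITY OF `U_p x = 0`: a partner forces
  `∑_{d mod p} x(s + d/p) = 0` for all `s` (for `x = [·]⁺_{f_E}`: `a_p(E) = 0` at an additive prime —
  consistent, and the reason no partner exists at a good or multiplicative prime unless `[·]⁺_f ≡ 0`);
* §2 `eq_zero_of_periodic_of_eq_mul_apply_mul` — the VANISHING LEMMA: a `1`-periodic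
  `Δ : ℚ → ℚ_p` with `Δ(s) = c·Δ(ps)` for all `s` and `‖c‖ ≠ 1` is identically `0` (write the
  denominator of `s` as `p^k·m`, `p ∤ m`; Euler: `m ∣ p^{φ(m)} − 1`, so `p^{φ(m)}·(p^k s) ≡ p^k s (mod ℤ)`
  and `Δ(p^k s) = c^{φ(m)}Δ(p^k s)` with `c^{φ(m)} ≠ 1`);
* §2 `partner_unique` — UNIQUENESS: two partners of `(x, χ)` with the same unit `ã` COINCIDE on all
  of `ℚ` (their difference satisfies `Δ = (ã/p)Δ(p·)`, `‖ã/p‖ = p ≠ 1`); with gen 21's tuple rigidity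
  (`IsTameBranchOf.tuple_eq`) the eigenvalue `ã` is itself pinned as soon as one tame branch is
  non-zero (§4);
* §3 `apply_intCast_eq`, `apply_div_pow_succ_eq`, `apply_div_pow_eq_sum` — THE TOWER FORMULA: for a
  partner, `Φ(a) = S(0)/(1 − ã/p)` for `a ∈ ℤ` and
  `Φ(a/pⁿ) = ∑_{j<n} (ã/p)^j · S(a/p^{n−j}) + (ã/p)ⁿ · S(0)/(1 − ã/p)`,
  so the tame-branch measure `μ(a + pⁿℤ_p) = ã⁻ⁿχ̄(a)Φ(a/pⁿ)` (`twistPartnerMeasure`, cc-typer-2) is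
  an EXPLICIT finite expression in the `χ`-twisted plus symbols of `f` itself — the ENGINE RECIPE for
  the census's owed `(μ^{an}, λ^{an})` column on the defect-3/4/6 (Gord_e346) rows, which have no
  quadratic-twist route (X42-WINDOW.md §0: "13 Gord_e346 window rows NOT run");
* sequel `TwistPartnerRigidityNewform.lean` (same gen): newform level `x = [·]⁺_f` — a partner
  forces `∑_d [s + d/p]⁺_f = 0`; uniqueness; on a row with `[0]⁺_f ≠ 0` (the X4-3 locus `r_an = 0`)
  the EIGENVALUE is pinned too (`ã' = ã`, via gen 21's `IsTameBranchOf.tuple_eq`); and at an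
  ADDITIVE prime of `E` the necessary condition HOLDS (`U_p f_E = a_p(E) f_E = 0`).

The companion file `TwistPartnerForced.lean` (same gen) WRITES DOWN the forced partner `Φ_{f,χ,ã}`
on all of `ℚ` and proves `HasOrdinaryTwistPartner χ f ↔ U_p[·]⁺_f = 0 ∧ ∃ ã, ‖ã‖ = 1 ∧ Φ_{f,χ,ã}`
bounded: the defect-3/4/6 existence input is ONE boundedness statement about an explicit function
(in print: Manin–Drinfeld for `f̃`), checkable per pair to any finite level.

References: B. Mazur, J. Tate, J. Teitelbaum, Invent. Math. 84 (1986) §I.8 (twisting operator),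
§I.10 (10.1)–(10.2) (`p`-stabilisation) [MazurTateTeitelbaum1986Invent]; A. O. L. Atkin, W. Li,
Invent. Math. 48 (1978) §3 [AtkinLi1978]; D. Delbourgo, Compositio Math. 113 (1998) §1.5
[Delbourgo1998]; HOME/class-closure/N10/TRANSPORT-TEMPLATE.md R2; ttrl/bsd-formula-census/X42-WINDOW.md
(sha256 a10a1709…; EVIDENCE, "Gord_e346 not run").
-/

noncomputable section

open scoped Classical MatrixGroups ModularForm

open CongruenceSubgroup

namespace Summit.BirchSwinnertonDyer.Rank1Residual.Additive

open Literature.NumberTheory.EllipticCurves Literature.NumberTheory.EllipticCurves.ModularForms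
  Literature.NumberTheory.EllipticCurves.Rank1Residual

namespace TwistPartner

/-! ### §1 The functional equation of a partner and the necessity of `U_p x = 0` -/

section Abstract

variable {p : ℕ} [hp : Fact p.Prime] {χ : MulChar (ZMod p) ℚ_[p]} {x Φ Φ' : ℚ → ℚ_[p]}
  {ã ã' : ℚ_[p]}

/-- `χ(−1)² = 1` for a multiplicative character of `ℤ/p`. [folklore] -/
theorem apply_neg_one_mul_self (χ : MulChar (ZMod p) ℚ_[p]) : χ (-1) * χ (-1) = 1 := by
  rw [← map_mul, neg_one_mul, neg_neg, map_one]

/-- `χ⁻¹(−1) = χ(−1)`. [folklore] -/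
theorem inv_apply_neg_one (χ : MulChar (ZMod p) ℚ_[p]) : χ⁻¹ (-1) = χ (-1) := by
  rw [MulChar.inv_apply', inv_neg_one]

/-- **THE FUNCTIONAL EQUATION OF AN ORDINARY TWIST PARTNER.** Let `χ ≠ 1`, `Φ : ℚ → ℚ_p`
`1`-periodic with (α) `x = τ_{χ⁻¹}Φ` and (β) `∑_{d mod p} Φ(s + d/p) = ã·Φ(ps)`. Then for every `s`:
`Φ(s) = (χ(−1)/p)·τ_χ x(s) + (ã/p)·Φ(ps)` — the partner is determined by `x` up to the "tail"
`Φ(p·)`. Proof: `τ_χ x = τ_χτ_{χ⁻¹}Φ = −χ(−1)∑_dΦ(· + d/p) + pχ(−1)Φ = −χ(−1)ãΦ(p·) + pχ(−1)Φ`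
(`CensusX43.twist_twist_inv`). [cite: MazurTateTeitelbaum1986Invent, §I.8 and §I.10 (10.1)] -/
theorem eq_source_add_mul (hχ : χ ≠ 1) (hper : ∀ s, Φ (s + 1) = Φ s)
    (hx : ∀ s, x s = CensusX43.twist χ⁻¹ Φ s)
    (hU : ∀ s, ∑ d : ZMod p, Φ (s + (d.val : ℚ) / p) = ã * Φ (p * s)) (s : ℚ) :
    Φ s = χ (-1) / p * CensusX43.twist χ x s + ã / p * Φ (p * s) := by
  have hp0 : (p : ℚ_[p]) ≠ 0 := Nat.cast_ne_zero.mpr hp.out.ne_zero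
  have htw : CensusX43.twist χ x s = -χ (-1) * (ã * Φ (p * s)) + (p : ℚ_[p]) * χ (-1) * Φ s := by
    have h := CensusX43.twist_twist_inv χ hχ hper s
    rw [hU] at h
    rw [← h]
    simp only [CensusX43.twist, hx]
  have h1 := apply_neg_one_mul_self χ
  have e1 : χ (-1) / p * (-χ (-1) * (ã * Φ (p * s))) = -(ã / p * Φ (p * s)) := by
    rw [show χ (-1) / (p : ℚ_[p]) * (-χ (-1) * (ã * Φ (p * s))) =
      -((χ (-1) * χ (-1)) * (ã / p * Φ (p * s))) by ring, h1, one_mul]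
  have e2 : χ (-1) / p * ((p : ℚ_[p]) * χ (-1) * Φ s) = Φ s := by
    rw [show χ (-1) / (p : ℚ_[p]) * ((p : ℚ_[p]) * χ (-1) * Φ s) =
      (χ (-1) * χ (-1)) * ((p : ℚ_[p]) / p) * Φ s by ring, h1, div_self hp0, one_mul, one_mul]
  rw [htw, mul_add, e1, e2]
  ring

/-- **A partner forces `U_p x = 0`**: under (α), (β) and `1`-periodicity (no hypothesis on `χ`
beyond `χ ≠ 1`), `∑_{d mod p} x(s + d/p) = 0` for every `s` — because
`∑_d τ_{χ⁻¹}Φ(s + d/p) = ∑_c χ̄(c)·ãΦ(ps + c) = ãΦ(ps)·∑_c χ̄(c) = 0`. For `x = [·]⁺_{f_E}` this is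
`a_p(E) = 0`, automatic at an additive prime (§5); at a good or multiplicative prime of a curve it
fails unless the symbols vanish, so no partner exists there. [folklore] -/
theorem sum_apply_add_div_eq_zero (hχ : χ ≠ 1) (hper : ∀ s, Φ (s + 1) = Φ s)
    (hx : ∀ s, x s = CensusX43.twist χ⁻¹ Φ s)
    (hU : ∀ s, ∑ d : ZMod p, Φ (s + (d.val : ℚ) / p) = ã * Φ (p * s)) (s : ℚ) :
    ∑ d : ZMod p, x (s + (d.val : ℚ) / p) = 0 := by
  have hp0 : (p : ℚ) ≠ 0 := Nat.cast_ne_zero.mpr hp.out.ne_zero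
  have hχi : χ⁻¹ ≠ 1 := fun h1 ↦ hχ (inv_eq_one.mp h1)
  simp only [hx, CensusX43.twist]
  rw [Finset.sum_comm]
  have hinner : ∀ c : ZMod p,
      ∑ d : ZMod p, χ⁻¹ c * Φ (s + (d.val : ℚ) / p + (c.val : ℚ) / p) =
        χ⁻¹ c * (ã * Φ (p * s)) := by
    intro c
    rw [← Finset.mul_sum]
    congr 1
    have h := hU (s + (c.val : ℚ) / p)
    have hps : Φ (p * (s + (c.val : ℚ) / p)) = Φ (p * s) := by
      rw [mul_add, mul_div_cancel₀ _ hp0, CensusX43.periodic_natCast hper]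
    rw [hps] at h
    rw [← h]
    refine Finset.sum_congr rfl fun d _ ↦ ?_
    rw [add_right_comm]
  simp_rw [hinner]
  rw [← Finset.sum_mul, MulChar.sum_eq_zero_of_ne_one hχi, zero_mul]

end Abstract

/-! ### §2 The vanishing lemma and uniqueness of the partner -/

section Vanishing

variable {p : ℕ} [hp : Fact p.Prime]

/-- Periodicity by integers from `1`-periodicity. [folklore] -/
theorem apply_add_intCast_of_periodic {Δ : ℚ → ℚ_[p]} (hper : ∀ s, Δ (s + 1) = Δ s) (s : ℚ)
    (z : ℤ) : Δ (s + z) = Δ s := by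
  have h : Function.Periodic Δ 1 := hper
  have h' := h.int_mul z s
  rwa [mul_one] at h'

/-- Iterating `Δ(s) = c·Δ(ps)`: `Δ(s) = c^k·Δ(p^k s)`. [folklore] -/
theorem apply_eq_pow_mul_apply_pow_mul {Δ : ℚ → ℚ_[p]} {c : ℚ_[p]}
    (hrec : ∀ s, Δ s = c * Δ (p * s)) (s : ℚ) (k : ℕ) :
    Δ s = c ^ k * Δ ((p : ℚ) ^ k * s) := by
  induction k generalizing s with
  | zero => rw [pow_zero, pow_zero, one_mul, one_mul]
  | succ k ih =>
    rw [ih s, hrec ((p : ℚ) ^ k * s), pow_succ, pow_succ, mul_assoc]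
    congr 2
    ring_nf

/-- Every rational `s` becomes, after multiplication by a suitable power `p^k`, a rational `t` with
`p^N·t − t ∈ ℤ` for some `N ≥ 1` (write `den s = p^k·m`, `p ∤ m`, and take `N = φ(m)`: Euler's
`m ∣ p^{φ(m)} − 1`). [folklore] -/
theorem exists_pow_mul_sub_mem_int (s : ℚ) :
    ∃ k N : ℕ, 1 ≤ N ∧ ∃ z : ℤ, (p : ℚ) ^ N * ((p : ℚ) ^ k * s) = (p : ℚ) ^ k * s + z := by
  obtain ⟨k, m, hm, hd⟩ :=
    Nat.exists_eq_pow_mul_and_not_dvd s.den_nz p hp.out.one_lt.ne'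
  have hm0 : m ≠ 0 := by
    rintro rfl
    exact s.den_nz (by rw [hd, mul_zero])
  have hcop : Nat.Coprime p m := (Nat.Prime.coprime_iff_not_dvd hp.out).mpr hm
  have heul : p ^ Nat.totient m ≡ 1 [MOD m] := Nat.ModEq.pow_totient hcop
  -- `m ∣ p^φ(m) − 1`
  have h1le : 1 ≤ p ^ Nat.totient m := Nat.one_le_pow _ _ hp.out.pos
  obtain ⟨q, hq⟩ : m ∣ p ^ Nat.totient m - 1 :=
    (Nat.modEq_iff_dvd' h1le).mp heul.symm
  refine ⟨k, Nat.totient m, Nat.totient_pos.mpr (Nat.pos_of_ne_zero hm0), q * s.num, ?_⟩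
  -- `p^k s = num / m`
  have hden : (s.den : ℚ) = (p : ℚ) ^ k * m := by exact_mod_cast hd
  have hms : (m : ℚ) * ((p : ℚ) ^ k * s) = s.num := by
    have h := Rat.mul_den_eq_num s
    rw [hden] at h
    linear_combination h
  have hpow : ((p : ℚ) ^ Nat.totient m) = 1 + m * q := by
    have h : p ^ Nat.totient m = 1 + m * q := by omega
    exact_mod_cast h
  rw [hpow]
  push_cast
  linear_combination (q : ℚ) * hms

/-- **THE VANISHING LEMMA.** A `1`-periodic `Δ : ℚ → ℚ_p` with `Δ(s) = c·Δ(ps)` for all `s`, where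
`‖c‖ ≠ 1`, vanishes identically: with `k, N` as in `exists_pow_mul_sub_mem_int`, `t = p^k s`
satisfies `Δ(t) = c^N Δ(p^N t) = c^N Δ(t)` (periodicity), so `Δ(t) = 0` (`c^N ≠ 1`), and
`Δ(s) = c^kΔ(t) = 0`. [folklore] -/
theorem eq_zero_of_periodic_of_eq_mul_apply_mul {Δ : ℚ → ℚ_[p]} {c : ℚ_[p]} (hc : ‖c‖ ≠ 1)
    (hper : ∀ s, Δ (s + 1) = Δ s) (hrec : ∀ s, Δ s = c * Δ (p * s)) (s : ℚ) : Δ s = 0 := by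
  obtain ⟨k, N, hN, z, hz⟩ := exists_pow_mul_sub_mem_int (p := p) s
  set t : ℚ := (p : ℚ) ^ k * s with ht
  have hΔt : Δ t = c ^ N * Δ t := by
    have h := apply_eq_pow_mul_apply_pow_mul hrec t N
    rwa [hz, apply_add_intCast_of_periodic hper] at h
  have hcN : c ^ N ≠ 1 := by
    intro h1
    have h2 : ‖c‖ ^ N = 1 := by rw [← norm_pow, h1, norm_one]
    exact hc ((pow_eq_one_iff_of_nonneg (norm_nonneg c) (by omega)).mp h2)
  have hΔt0 : Δ t = 0 := by
    have h : (1 - c ^ N) * Δ t = 0 := by linear_combination hΔt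
    exact (mul_eq_zero.mp h).resolve_left (sub_ne_zero.mpr (Ne.symm hcN))
  rw [apply_eq_pow_mul_apply_pow_mul hrec s k, ← ht, hΔt0, mul_zero]

/-- `‖ã/p‖ = p ≠ 1` for a unit `ã`. [folklore] -/
theorem norm_div_natCast_ne_one {ã : ℚ_[p]} (hã : ‖ã‖ = 1) : ‖ã / (p : ℚ_[p])‖ ≠ 1 := by
  rw [norm_div, hã, Padic.norm_p, one_div, inv_inv]
  exact_mod_cast hp.out.one_lt.ne'

variable {χ : MulChar (ZMod p) ℚ_[p]} {x Φ Φ' : ℚ → ℚ_[p]} {ã : ℚ_[p]}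

/-- **UNIQUENESS OF THE PARTNER FOR A GIVEN UNIT.** Two `1`-periodic partners `Φ, Φ'` of `(x, χ)`
(`χ ≠ 1`) with the same unit eigenvalue `ã` coincide on ALL of `ℚ`: both satisfy the functional
equation of `eq_source_add_mul` with the same source, so `Δ = Φ − Φ'` satisfies `Δ = (ã/p)Δ(p·)`
with `‖ã/p‖ = p ≠ 1`, and the vanishing lemma applies. (No boundedness is used.) [folklore] -/
theorem partner_unique (hχ : χ ≠ 1) (hã : ‖ã‖ = 1)
    (hper : ∀ s, Φ (s + 1) = Φ s) (hx : ∀ s, x s = CensusX43.twist χ⁻¹ Φ s)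
    (hU : ∀ s, ∑ d : ZMod p, Φ (s + (d.val : ℚ) / p) = ã * Φ (p * s))
    (hper' : ∀ s, Φ' (s + 1) = Φ' s) (hx' : ∀ s, x s = CensusX43.twist χ⁻¹ Φ' s)
    (hU' : ∀ s, ∑ d : ZMod p, Φ' (s + (d.val : ℚ) / p) = ã * Φ' (p * s)) : Φ' = Φ := by
  funext s
  have hΔ : ∀ s, (Φ' s - Φ s) = ã / p * (Φ' (p * s) - Φ (p * s)) := by
    intro s
    have h1 := eq_source_add_mul hχ hper hx hU s
    have h2 := eq_source_add_mul hχ hper' hx' hU' s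
    linear_combination h2 - h1
  have h0 := eq_zero_of_periodic_of_eq_mul_apply_mul (Δ := fun s ↦ Φ' s - Φ s)
    (norm_div_natCast_ne_one hã) (fun s ↦ by simp only [hper, hper']) hΔ s
  exact sub_eq_zero.mp h0

end Vanishing

/-! ### §3 The tower formula: the partner, hence the tame-branch measure, explicitly -/

section Tower

variable {p : ℕ} [hp : Fact p.Prime] {χ : MulChar (ZMod p) ℚ_[p]} {x Φ : ℚ → ℚ_[p]} {ã : ℚ_[p]}

/-- `1 − ã/p ≠ 0` for a unit `ã`. [folklore] -/
theorem one_sub_div_ne_zero (hã : ‖ã‖ = 1) : 1 - ã / (p : ℚ_[p]) ≠ 0 := by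
  intro h
  have h1 : ã / (p : ℚ_[p]) = 1 := by linear_combination -h
  exact norm_div_natCast_ne_one hã (by rw [h1, norm_one])

/-- **The partner at integers**: `Φ(a) = Φ(0) = S(0)/(1 − ã/p)` with `S(0) = (χ(−1)/p)·τ_χ x(0)` —
the functional equation at `s = 0` (`p·0 = 0`). [folklore] -/
theorem apply_intCast_eq (hχ : χ ≠ 1) (hã : ‖ã‖ = 1) (hper : ∀ s, Φ (s + 1) = Φ s)
    (hx : ∀ s, x s = CensusX43.twist χ⁻¹ Φ s)
    (hU : ∀ s, ∑ d : ZMod p, Φ (s + (d.val : ℚ) / p) = ã * Φ (p * s)) (a : ℤ) :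
    Φ a = (1 - ã / p)⁻¹ * (χ (-1) / p * CensusX43.twist χ x 0) := by
  have ha : Φ a = Φ 0 := by
    have h := apply_add_intCast_of_periodic hper 0 a
    rwa [zero_add] at h
  have h0 := eq_source_add_mul hχ hper hx hU 0
  rw [mul_zero] at h0
  rw [ha, eq_inv_mul_iff_mul_eq₀ (one_sub_div_ne_zero hã)]
  linear_combination h0

/-- **One step down the tower**: `Φ(a/p^{n+1}) = S(a/p^{n+1}) + (ã/p)·Φ(a/pⁿ)`. [folklore] -/
theorem apply_div_pow_succ_eq (hχ : χ ≠ 1) (hper : ∀ s, Φ (s + 1) = Φ s)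
    (hx : ∀ s, x s = CensusX43.twist χ⁻¹ Φ s)
    (hU : ∀ s, ∑ d : ZMod p, Φ (s + (d.val : ℚ) / p) = ã * Φ (p * s)) (a : ℚ) (n : ℕ) :
    Φ (a / (p : ℚ) ^ (n + 1)) =
      χ (-1) / p * CensusX43.twist χ x (a / (p : ℚ) ^ (n + 1)) + ã / p * Φ (a / (p : ℚ) ^ n) := by
  have hp0 : (p : ℚ) ≠ 0 := Nat.cast_ne_zero.mpr hp.out.ne_zero
  have h := eq_source_add_mul hχ hper hx hU (a / (p : ℚ) ^ (n + 1))
  have hps : (p : ℚ) * (a / (p : ℚ) ^ (n + 1)) = a / (p : ℚ) ^ n := by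
    rw [pow_succ]; field_simp
  rwa [hps] at h

/-- **THE TOWER FORMULA.** For a partner `(Φ, ã)` of `(x, χ)` (`χ ≠ 1`, `‖ã‖ = 1`), every `a ∈ ℤ`
and every `n`:
`Φ(a/pⁿ) = ∑_{j<n} (ã/p)^j · S(a/p^{n−j}) + (ã/p)ⁿ · S(0)/(1 − ã/p)`, `S = (χ(−1)/p)·τ_χ x`.
With cc-typer-2's `twistPartnerMeasure χ Φ ã x₀ (n+1) a = ã^{−(n+1)}χ̄(a)Φ(a/p^{n+1})` this makes the
tame-branch measure of `exists_isTameBranchOf_of_twistPartnerData` an explicit finite expression in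
the `χ`-twisted values of `x` — for `x = [·]⁺_{f_E}` on a defect-3/4/6 row, the census ENGINE recipe
for the E-normalised tame branch (Mazur–Tate–Teitelbaum's one-term measure of the `p`-stabilised
twist, written in `E`'s own symbols). [cite: MazurTateTeitelbaum1986Invent, §I.10 (10.1)] -/
theorem apply_div_pow_eq_sum (hχ : χ ≠ 1) (hã : ‖ã‖ = 1) (hper : ∀ s, Φ (s + 1) = Φ s)
    (hx : ∀ s, x s = CensusX43.twist χ⁻¹ Φ s)
    (hU : ∀ s, ∑ d : ZMod p, Φ (s + (d.val : ℚ) / p) = ã * Φ (p * s)) (a : ℤ) (n : ℕ) :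
    Φ (a / (p : ℚ) ^ n) =
      ∑ j ∈ Finset.range n,
          (ã / p) ^ j * (χ (-1) / p * CensusX43.twist χ x (a / (p : ℚ) ^ (n - j))) +
        (ã / p) ^ n * ((1 - ã / p)⁻¹ * (χ (-1) / p * CensusX43.twist χ x 0)) := by
  induction n with
  | zero =>
    rw [Finset.sum_range_zero, zero_add, pow_zero, div_one, pow_zero, one_mul]
    exact apply_intCast_eq hχ hã hper hx hU a
  | succ n ih =>
    rw [apply_div_pow_succ_eq hχ hper hx hU (a : ℚ) n, ih, Finset.sum_range_succ', pow_zero,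
      one_mul, Nat.sub_zero, mul_add, Finset.mul_sum, pow_succ]
    have hterm : ∀ j ∈ Finset.range n,
        ã / p * ((ã / p) ^ j * (χ (-1) / p * CensusX43.twist χ x (a / (p : ℚ) ^ (n - j)))) =
          (ã / p) ^ (j + 1) * (χ (-1) / p * CensusX43.twist χ x (a / (p : ℚ) ^ (n + 1 - (j + 1)))) := by
      intro j _
      rw [show n + 1 - (j + 1) = n - j by omega, pow_succ]
      ring
    rw [Finset.sum_congr rfl hterm]
    ring

end Tower

end TwistPartner

end Summit.BirchSwinnertonDyer.Rank1Residual.Additive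

end
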